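import Mathlib
import HarnessLib
import Summits.HubbardSuperconductivity.HubbardSuperconductivity.Theorems.KLProgrammeKLRegimeSplitGenericV2

/-!
# Route `KLProgramme` — ENGINE child gen 8 (stmt-HubbardSuperconductivity-20437 `KLRegimeEngineV17F2`), v2 DefsU11 min-list: the (F)(i) INSURANCE ROW
# `klE5FrU G R` (plan g21 (R54ac)(2); cell gate-hubbard-kl, seat hubbard-kl-k3c2-p2 g13 = (F)(i) re-framing door owner)

WHY.  Class #5 rev 3 keys the relative transfer bar on frame-free INDEX weights with the prefactor `klIdxPrefactor r n = r·(2 − 2⁻ⁿ)`, whose per-step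
multiplicative slack `(1 + 2^{−(n+2)})` is the SLOT OF RECORD for the (F)(i) re-framing defect of the inherited relative residue (pen (R54ab)).  That defect is
relative `≤ c′·Gfr₀·U·4^{−n}/klE0` (KL STATUS 2026-08-28 l.4289/l.4312; `…PolarRayCoareaReframe(Integral)` p589719/p590066 certify its level-coordinate part), so it
fits iff `4·c′·R.Gfr 0·U ≤ klE0`.  For every `c′` that is a numeral × a P/R-polynomial the EXISTING door `klEngU₀3` already hosts it; this file books the ONE
reading that cannot be excluded before T+ — a `c′` keyed to the geometry package's (E4) constant `G.cE4` (if the (c) closer's source decomposition reads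
the running arrays' momentum regularity through `cE4`): an existential-`U₀` min-entry, free before the 08-29 FREEZE and impossible after.

* `klE5FrU G R := klE0/(2^24·(G.cE4 + 1)·(R.Gfr 0 + 1))` — G-generic (DefsU11 instantiates at `klEngGeo9`);
* `klE5FrU_pos` (`0 ≤ G.cE4`, `0 ≤ R.Gfr 0`; `_of_wf` from `G.WF`, `R.WF2`);
* **`klE5FrU_host`** — the hosting inequality: `0 ≤ U ≤ klE5FrU G R`, `0 ≤ c′ ≤ 2^22·(G.cE4 + 1)` ⟹ `4·c′·R.Gfr 0·U ≤ klE0` (so `c′·Gfr₀·U·4^{−n}/klE0 ≤ 2^{−(n+2)}` at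
  every `n`, `klE5FrU_slot`).

Definitions with bodies + two inequalities; nothing about the model is asserted; nothing asserts superconductivity.
-/

noncomputable section

namespace Summit.HubbardSuperconductivity.HubbardSuperconductivity.Theorems.EngineV8

set_option linter.dupNamespace false -- summit = problem name (single-conjunct summit), D-0017

open Real Summit.HubbardSuperconductivity.HubbardSuperconductivity.Theorems.KLRegimeSplit

/-- **`klE5FrU G R := klE0/(2^24·(G.cE4 + 1)·(R.Gfr 0 + 1))`** — the (F)(i) insurance threshold of the v2 `klEngU₀11` min-list ((R54ac)(2)). -/
def klE5FrU (G : GeoConsts) (R : RenConsts) : ℝ := klE0 / ((2 : ℝ) ^ 24 * (G.cE4 + 1) * (R.Gfr 0 + 1))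

/-- Unfolding `klE5FrU`. -/
theorem klE5FrU_eq (G : GeoConsts) (R : RenConsts) : klE5FrU G R = klE0 / ((2 : ℝ) ^ 24 * (G.cE4 + 1) * (R.Gfr 0 + 1)) := rfl

/-- **`0 < klE5FrU G R`** (`0 ≤ G.cE4`, `0 ≤ R.Gfr 0`). -/
theorem klE5FrU_pos {G : GeoConsts} {R : RenConsts} (hG : 0 ≤ G.cE4) (hR : 0 ≤ R.Gfr 0) : 0 < klE5FrU G R := by
  unfold klE5FrU klE0
  positivity

/-- `0 < klE5FrU G R` from the packages' well-formedness (`G.WF`, `R.WF2`). -/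
theorem klE5FrU_pos_of_wf {G : GeoConsts} {R : RenConsts} (hG : G.WF) (hR : R.WF2) : 0 < klE5FrU G R :=
  klE5FrU_pos hG.2.2.2.2.2.2.2.2.2.2.2.2.2.2.2.2.1 (hR.1.2.2 0)

/-- **THE HOSTING INEQUALITY**: below the threshold, every relative-slack constant `c′ ≤ 2^22·(G.cE4 + 1)` satisfies `4·c′·R.Gfr 0·U ≤ klE0`
(`0 ≤ U ≤ klE5FrU G R`, `0 ≤ G.cE4`, `0 ≤ R.Gfr 0`; no sign condition on `c′`). -/
theorem klE5FrU_host {G : GeoConsts} {R : RenConsts} (hG : 0 ≤ G.cE4) (hR : 0 ≤ R.Gfr 0) {U c' : ℝ} (hU0 : 0 ≤ U) (hU : U ≤ klE5FrU G R)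
    (hc : c' ≤ (2 : ℝ) ^ 22 * (G.cE4 + 1)) : 4 * c' * R.Gfr 0 * U ≤ klE0 := by
  have hE0 : (0 : ℝ) < klE0 := by norm_num [klE0]
  have hden : 0 < (2 : ℝ) ^ 24 * (G.cE4 + 1) * (R.Gfr 0 + 1) := by positivity
  -- `4·c′·Gfr₀·U ≤ 4·2^22(cE4+1)·Gfr₀·klE5FrU = klE0·Gfr₀/(Gfr₀+1) ≤ klE0`
  have h1 : 4 * c' * R.Gfr 0 * U ≤ 4 * ((2 : ℝ) ^ 22 * (G.cE4 + 1)) * R.Gfr 0 * klE5FrU G R := by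
    have ha : 4 * c' * R.Gfr 0 ≤ 4 * ((2 : ℝ) ^ 22 * (G.cE4 + 1)) * R.Gfr 0 :=
      mul_le_mul_of_nonneg_right (mul_le_mul_of_nonneg_left hc (by norm_num)) hR
    exact mul_le_mul ha hU hU0 (by positivity)
  refine h1.trans ?_
  rw [klE5FrU_eq, mul_div_assoc', div_le_iff₀ hden]
  have hG1 : 0 ≤ R.Gfr 0 * klE0 := mul_nonneg hR hE0.le
  nlinarith

/-- **THE SLOT FORM**: below the threshold, `c′·R.Gfr 0·U·4^{−n}/klE0 ≤ 2^{−(n+2)}` at every scale `n` (the IDX prefactor's per-step slack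
`klIdxPrefactor_succ_slack`), for every `c′ ≤ 2^22·(G.cE4 + 1)`. -/
theorem klE5FrU_slot {G : GeoConsts} {R : RenConsts} (hG : 0 ≤ G.cE4) (hR : 0 ≤ R.Gfr 0) {U c' : ℝ} (hU0 : 0 ≤ U) (hU : U ≤ klE5FrU G R)
    (hc0 : 0 ≤ c') (hc : c' ≤ (2 : ℝ) ^ 22 * (G.cE4 + 1)) (n : ℕ) :
    c' * R.Gfr 0 * U * ((4 : ℝ) ^ n)⁻¹ / klE0 ≤ ((2 : ℝ) ^ (n + 2))⁻¹ := by
  have hE0 : (0 : ℝ) < klE0 := by norm_num [klE0]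
  have hhost := klE5FrU_host hG hR hU0 hU hc
  have h4 : (0 : ℝ) < 4 ^ n := by positivity
  have h2 : (0 : ℝ) < 2 ^ (n + 2) := by positivity
  -- `4^{-n} ≤ 2^{-n}` and `c′Gfr₀U/klE0 ≤ 1/4`
  have hq : c' * R.Gfr 0 * U / klE0 ≤ 1 / 4 := by
    rw [div_le_iff₀ hE0]; linarith
  have hpow : ((4 : ℝ) ^ n)⁻¹ ≤ ((2 : ℝ) ^ n)⁻¹ := by
    apply inv_anti₀ (by positivity)
    have : (2 : ℝ) ^ n ≤ 4 ^ n := pow_le_pow_left₀ (by norm_num) (by norm_num) n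
    exact this
  have hx0 : 0 ≤ c' * R.Gfr 0 * U / klE0 := by positivity
  calc c' * R.Gfr 0 * U * ((4 : ℝ) ^ n)⁻¹ / klE0 = c' * R.Gfr 0 * U / klE0 * ((4 : ℝ) ^ n)⁻¹ := by ring
    _ ≤ 1 / 4 * ((2 : ℝ) ^ n)⁻¹ := mul_le_mul hq hpow (by positivity) (by norm_num)
    _ = ((2 : ℝ) ^ (n + 2))⁻¹ := by rw [pow_add]; norm_num

end Summit.HubbardSuperconductivity.HubbardSuperconductivity.Theorems.EngineV8

end
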